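import Summits.HubbardSuperconductivity.HubbardSuperconductivity.Theorems.LogColdTorusThermalChargeDephasingHastings

/-!
# Route `LogColdTorus`, support `ThermalChargeDephasing` (item `stmt-HubbardSuperconductivity-8813`), part 2: the Hubbard torus

CHARGE `e` IS THERMALLY DEAD, with constants UNIFORM in the chemical potential: for every `U`
there are `C, c₀ > 0` such that for all `μ`, all `β ≥ 1`, all sides `L` and all torus sites
`x, y` and spins `σ`, `|⟨c†_{xσ} c_{yσ}⟩_{β,L,U,μ}| ≤ C·exp(-c₀·dist(x,y)/β)` — Hastings' thermal
decay of fermionic correlations (PRL 93 (2004) 126402, eq. (1), `ξ ≤ max(ξ_C, vβ/π)`) for the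
Hubbard torus with the Lieb–Robinson velocity of `H(1,U)` alone. Inputs: the abstract estimate
`norm_gibbsState_mul_le_of_anticommutator_decay` and the interaction picture in the charge
(`heisenbergEvolution_hamiltonianWith_creation/annihilation`) of part 1, and the tree's
anticommutator Lieb–Robinson bound `norm_anticommutator_hubbardTorus_le` at `μ = 0`.

Sources: M. B. Hastings, Phys. Rev. Lett. 93 (2004) 126402 = arXiv:cond-mat/0406348, eq. (1) and
the paragraph after eq. (13); M. B. Hastings, T. Koma, CMP 265 (2006) 781, App. A.
-/

set_option linter.dupNamespace false

noncomputable section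

namespace Summit.HubbardSuperconductivity.HubbardSuperconductivity.Theorems.LogColdTorus

open MeasureTheory Set Filter Matrix Complex Finset
open Literature.MathematicalPhysics.QuantumLattice Literature.Probability.LatticeModels
open Summit.HubbardSuperconductivity.HubbardSuperconductivity.Theses.LogColdTorus
open scoped Matrix.Norms.L2Operator ComplexOrder

/-! ### The Hubbard torus: Hastings' bound with `μ`-independent constants -/

section Torus

variable {L : ℕ} [NeZero L]

/-- **Hastings' bound for the thermal one-body density matrix of the Hubbard torus, constants
uniform in `μ`**: for `β ≥ 1` and all `μ`,
`|⟨c†_{xσ} c_{yσ}⟩_{β,L,U,μ}| ≤ (e + C₁(U)) exp(-c₀(U) dist(x,y)/β)` with the `μ = 0` constants of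
`norm_gibbsState_creation_annihilation_le` (`J = 2 + |U|`, `κ = 36eJ`, `c₀ = min(1/4, π/(2κ))`):
the interaction picture in the charge (`heisenbergEvolution_hamiltonianWith_creation`) reduces
the anticommutator Lieb–Robinson bound for `H - μN` to the one for `H`
(`norm_anticommutator_hubbardTorus_le` at `μ = 0`), and the abstract estimate
`norm_gibbsState_mul_le_of_anticommutator_decay` does the rest.
[cite: HastingsPRL2004FermiDecay, eq. (1) and the paragraph after eq. (13)] -/
theorem norm_gibbsState_creation_annihilation_le_uniform (U μ β : ℝ) (L : ℕ) [NeZero L]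
    [instDE : DecidableEq (FermionTorus 2 L)] (hβ : 1 ≤ β) (x y : TorusSite 2 L) (σ : Fin 2) :
    ‖(hubbardTorusWith 2 L 1 U μ).gibbsState β
        ((annihilation (orb (FermionTorus.ofTorusSite x) σ))ᴴ *
          annihilation (orb (FermionTorus.ofTorusSite y) σ))‖ ≤
      (Real.exp 1 +
        (36 * (2 * |(1 : ℝ)| + |U| + 2 * |(0 : ℝ)|) * Real.exp 1 / Real.pi *
            (1 / (2 * (Real.exp 1 * (2 * (2 * |(1 : ℝ)| + |U| + 2 * |(0 : ℝ)|) * (2 * (2 * 4 + 1) : ℕ))))) *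
            (4 / Real.exp 1) +
          4 / (Real.pi * (1 - Real.exp (-2))))) *
        Real.exp (-(min (1 / 4 : ℝ) (Real.pi / (2 * (Real.exp 1 * (2 * (2 * |(1 : ℝ)| + |U| + 2 * |(0 : ℝ)|) *
          (2 * (2 * 4 + 1) : ℕ))))) * (torusDist x y : ℝ) / β)) := by
  -- instance bookkeeping (see `norm_anticommutator_hubbardTorus_le`)
  obtain rfl : instDE = LinearOrder.toDecidableEq := Subsingleton.elim _ _
  letI instDE : DecidableEq (FermionTorus 2 L) := LinearOrder.toDecidableEq
  -- constants (those of `μ = 0`)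
  set J : ℝ := 2 * |(1 : ℝ)| + |U| + 2 * |(0 : ℝ)| with hJ
  set κ : ℝ := Real.exp 1 * (2 * J * (2 * (2 * 4 + 1) : ℕ)) with hκ
  set K₁ : ℝ := 36 * J * Real.exp 1 with hK₁
  have hJpos : 0 < J := by
    have h1 : |(1 : ℝ)| = 1 := abs_one
    have := abs_nonneg U; rw [hJ, abs_zero]; linarith
  have hκpos : 0 < κ := by positivity
  have hK₁pos : 0 < K₁ := by positivity
  set H := hubbardTorusWith 2 L 1 U μ with hH_def
  have hH : H.IsHermitian := isHermitian_hamiltonianWith (fermionTorusGraph 2 L) 1 U μ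
  set xF : FermionTorus 2 L := FermionTorus.ofTorusSite x with hxF
  set yF : FermionTorus 2 L := FermionTorus.ofTorusSite y with hyF
  set A : Matrix (Finset (Orb (FermionTorus 2 L))) (Finset (Orb (FermionTorus 2 L))) ℂ :=
    creation (orb xF σ) with hA_def
  set B : Matrix (Finset (Orb (FermionTorus 2 L))) (Finset (Orb (FermionTorus 2 L))) ℂ :=
    annihilation (orb yF σ) with hB_def
  change ‖gibbsState β H (A * B)‖ ≤ (Real.exp 1 + (K₁ / Real.pi * (1 / (2 * κ)) * (4 / Real.exp 1) +
    4 / (Real.pi * (1 - Real.exp (-2))))) * Real.exp (-(min (1 / 4 : ℝ) (Real.pi / (2 * κ)) *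
      (torusDist x y : ℝ) / β))
  have hA1 : ‖A‖ ≤ 1 := norm_creation_le_one _
  have hB1 : ‖B‖ ≤ 1 := norm_annihilation_le_one _
  have hAmem : A ∈ carSubalgebra (orbSet ({xF} : Finset (FermionTorus 2 L))) :=
    creation_mem_carSubalgebra (orb_mem_orbSet (Finset.mem_singleton_self xF) σ)
  have hBmem : B ∈ carSubalgebra (orbSet ({yF} : Finset (FermionTorus 2 L))) :=
    annihilation_mem_carSubalgebra (orb_mem_orbSet (Finset.mem_singleton_self yF) σ)
  have hAodd : parityOp * A = -(A * parityOp) := parityOp_mul_creation _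
  have hBodd : parityOp * B = -(B * parityOp) := parityOp_mul_annihilation_holds _
  -- `{c†_x, c_y} = 0` for `x ≠ y`, i.e. for positive separation
  have hAB0 : 0 < (torusDist x y : ℝ) → A * B + B * A = 0 := by
    intro hl0
    have hxy : x ≠ y := by
      intro h
      rw [h, torusDist_self, Nat.cast_zero] at hl0
      exact lt_irrefl _ hl0
    have horb : orb xF σ ≠ orb yF σ := by
      intro h
      apply hxy
      have h2 : xF = yF := by
        have := congrArg (fun k : Orb (FermionTorus 2 L) => (ofLex k).1) h
        simpa using this
      rw [← FermionTorus.toTorusSite_ofTorusSite x, ← FermionTorus.toTorusSite_ofTorusSite y, ← hxF,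
        ← hyF, h2]
    have h := annihilation_mul_creation_add_creation_mul_annihilation_holds
      (ι := Orb (FermionTorus 2 L)) (orb yF σ) (orb xF σ)
    rw [if_neg horb.symm, add_comm] at h
    exact h
  -- the anticommutator Lieb–Robinson bounds, through the interaction picture in the charge
  have hLRp : ∀ t : ℝ, 0 ≤ t →
      ‖heisenbergEvolution H t A * B + B * heisenbergEvolution H t A‖ ≤
        ‖A * B + B * A‖ + K₁ * t * Real.exp (κ * t - (torusDist x y : ℝ)) := by
    intro t ht
    have hgauge : heisenbergEvolution H t A =
        cexp ((((-(t * μ) : ℝ)) : ℂ) * I) • heisenbergEvolution (hubbardTorus 2 L 1 U) t A :=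
      heisenbergEvolution_hamiltonianWith_creation (fermionTorusGraph 2 L) 1 U μ t (orb xF σ)
    rw [hgauge, norm_smul_anticommutator, Complex.norm_exp_ofReal_mul_I, one_mul]
    have h := norm_anticommutator_hubbardTorus_le U 0 x y hAmem hBmem hAodd hA1 hB1 ht
    rw [hubbardTorusWith_zero] at h
    exact h
  have hLRn : ∀ t : ℝ, 0 ≤ t →
      ‖heisenbergEvolution H (-t) A * B + B * heisenbergEvolution H (-t) A‖ ≤
        ‖B * A + A * B‖ + K₁ * t * Real.exp (κ * t - (torusDist x y : ℝ)) := by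
    intro t ht
    rw [norm_anticommutator_heisenbergEvolution_neg hH t A B]
    have hgauge : heisenbergEvolution H t B =
        cexp ((((t * μ) : ℝ) : ℂ) * I) • heisenbergEvolution (hubbardTorus 2 L 1 U) t B :=
      heisenbergEvolution_hamiltonianWith_annihilation (fermionTorusGraph 2 L) 1 U μ t (orb yF σ)
    rw [hgauge, norm_smul_anticommutator, Complex.norm_exp_ofReal_mul_I, one_mul]
    have h := norm_anticommutator_hubbardTorus_le U 0 y x hBmem hAmem hBodd hB1 hA1 ht
    rw [hubbardTorusWith_zero, torusDist_comm' y x] at h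
    exact h
  exact norm_gibbsState_mul_le_of_anticommutator_decay hH hA1 hB1 hK₁pos hκpos (Nat.cast_nonneg _)
    hβ hAB0 hLRp hLRn

/-- **`ThermalChargeDephasing` holds** (route `LogColdTorus`, support item
`stmt-HubbardSuperconductivity-8813`): for every `U` there are `C, c₀ > 0` such that for all `μ`,
`β ≥ 1`, sides `L`, torus sites `x, y` and spins `σ`,
`|⟨c†_{xσ} c_{yσ}⟩_{β,L,U,μ}| ≤ C·exp(-c₀·dist(x,y)/β)` — Hastings' thermal decay of fermionic
correlations (PRL 93 (2004) 126402, eq. (1), `ξ ≤ max(ξ_C, vβ/π)`), with the Lieb–Robinson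
velocity of `H(1,U)` alone (the chemical-potential term is removed by the interaction picture in
the charge). -/
theorem thermalChargeDephasing_proof : ThermalChargeDephasing := by
  intro U
  refine ⟨_, _, ?_, fun μ β L _ hβ x y σ =>
    norm_gibbsState_creation_annihilation_le_uniform U μ β L hβ x y σ⟩
  exact lt_min (by norm_num) (by positivity)

end Torus

end Summit.HubbardSuperconductivity.HubbardSuperconductivity.Theorems.LogColdTorus
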